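import Mathlib
import Summits.ResolutionOfSingularities.ResolutionOfSingularities.Theorems.WeightedInvariantLocalWeightedDropTameN4PreparedWonOfWinsIn
import Summits.ResolutionOfSingularities.ResolutionOfSingularities.Theorems.WeightedInvariantLocalWeightedDropTschirnhausForm
import Summits.ResolutionOfSingularities.ResolutionOfSingularities.Theorems.WeightedInvariantLocalWeightedDropPurePowerWon
import Summits.ResolutionOfSingularities.ResolutionOfSingularities.Theorems.WeightedInvariantLocalWeightedDropNCProductCorollaries
import Summits.ResolutionOfSingularities.ResolutionOfSingularities.Theorems.WeightedInvariantLocalWeightedDropNCToricRungClosed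

/-!
# `WeightedInvariant.LocalWeightedDrop`, residual T″|₄ `stub_tameWideApexFourStartsWon` (skeleton v31): F-D — the SUPPORT CLASSES of the
# relative tame-multiplicity lift: Tschirnhaus presentations with finitely NC-winnable support product are won, and the landed TOT₂ classes
# (cylinders over plane curves, arrangements) as instances; the `d = 2` headline `y² + a₀`

Crux item stmt-ResolutionOfSingularities-8899 `LocalWeightedDrop` (route `ResolutionOfSingularities/WeightedInvariant`), engine skeleton
v31 (res-L1-w43-lead-1, fb48e93459d3708f), residual T″|₄.  [OURS · L1 W4.3, chain w43, res-L1-w43-stub-3 (gen 4) = second hand on (K-b) of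
`L/res-L1-w43-stub-1/N4-TAME-CENSUS.md` v1.1 / `KB-DESIGN.md`; file F-D as NAMED by res-L1-w43-stub-1 (STATUS 2026-08-27T10:35:08Z) on top of
its landed F-B `TameN4.multiplicityLift_rel` (p523186) and F-A/F-C `TameN4.stepDrop_of_winsIn` / `TameN4.preparedWon_of_winsIn` (p523892); the
TOT₂ classes are res-D-pv-006's / res-type-088's NC-transport files (`NCTransport.winsIn_plane`, `winsIn_germIsNC_cylinder`,
`exists_winsIn_arrangement`).  Nothing here is a statement of H. Hironaka's manuscript; the games are the programme's own; AI-written,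
gate-accepted means sorry-free with standard axioms, not refereed.  Definition-free.]

* (d1) **`won_of_presentation_winsIn`** (every number `m + 2` of variables): a germ `f` with a PRESENTATION `f ∘ θ = U · y^{e+2} + Σ a_j y^j`
  (`θ` legal, `U(0) ≠ 0`, `a` bad, `(e + 2 : k) ≠ 0`) whose tuple is zero or has FINITELY NC-WINNABLE support product `∏_{a_j ≠ 0} a_j` is won,
  given the singular germs of order `< e + 2` — `won_subst_iff` + `stub_purePowerWon` / `TameN4.preparedWon_of_winsIn`;
  **`won_of_tschirnhaus_winsIn`** — the same for a tame singular `f` of order `e + 2` (`p ∤ e + 2`, `k` algebraically closed) when EVERY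
  Tschirnhaus presentation (`stub_tschirnhausForm`) has that property; `…four…` specialisations at `m + 2 = 4`.
* (d2) support classes at `m + 1 = 3` letters: `winsIn_three_cylinder_plane` (cylinder over a non-zero plane germ along the last letter —
  `winsIn_plane` + `winsIn_germIsNC_cylinder 1 0`), `winsIn_three_arrangement` (unit · product of linear forms — `exists_winsIn_arrangement`).
* (d3) **`won_doublePoint_of_winsIn`** — the `d = 2` headline: `y² + a₀` with `a₀ ≠ 0` of order `≥ 2` FINITELY NC-WINNABLE and `2 ≠ 0` in `k` is
  won in `m + 2` variables (the lower-order hypothesis is vacuous at order `2`); instances `won_four_doublePoint_arrangement` (e.g.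
  `y² + x₀x₁x₂(x₀+x₁+x₂)`, `p ≠ 2`) and `won_four_doublePoint_cylinder_plane` (`y² + c(x₀,x₁)`, also a class-#3 cylinder).
WHAT THIS BUYS (census (V) → all multiplicities): with (K-c) `TameN4.tot_suspension_tame` (res-L1-w43-stub-2, in flight) the support class
«`x₂^m + c(x₀,x₁)`» plugs into (d1)/(d3) verbatim, covering the census's first uncovered start `y² + x₂³ + (x₀² − x₁³)²` (`p ≥ 5`).
-/

set_option linter.dupNamespace false -- mandated namespace of this single-conjunct summit
set_option autoImplicit false

namespace Summit.ResolutionOfSingularities.ResolutionOfSingularities.Theorems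

open Literature.AlgebraicGeometry.Resolution
open Literature.AlgebraicGeometry.Resolution.CobordantGame

namespace TameN4

open MvPowerSeries TameFourTupleDrop NCTransport NCArrangement

variable {k : Type} [Field k]

/-! ## (d1) Presentations with finitely NC-winnable support product -/

/-- The prepared germ of the ZERO tuple is the pure power `U · y^{e+2}`. -/
theorem germ_zero_eq {m e : ℕ} (U : MvPowerSeries (Fin (m + 1)) k) :
    TupleGame.germ U (0 : Fin (e + 1) → MvPowerSeries (Fin m) k) = U * MvPowerSeries.X (Fin.last m) ^ (e + 2) := by
  unfold TupleGame.germ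
  simp

/-- **A PRESENTED GERM WITH FINITELY NC-WINNABLE SUPPORT PRODUCT IS WON** (every number `m + 2` of variables, multiplicity `e + 2` invertible
in `k`): if `f ∘ θ = U · y^{e+2} + Σ_{j ≤ e} a_j y^j` for a legal coordinate change `θ`, a unit `U` and a bad tuple `a` on `k⟦x₀,…,x_m⟧` that is
zero or whose support product `∏_{a_j ≠ 0} a_j` is finitely NC-winnable, and every singular germ of order `< e + 2` in `m + 2` variables is won,
then `f` is won.  (`won_subst_iff`; zero tuple: `stub_purePowerWon`; otherwise res-L1-w43-stub-1's `TameN4.preparedWon_of_winsIn`.)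
[OURS · L1 W4.3] -/
theorem won_of_presentation_winsIn (p : ℕ) (hp : p.Prime) (k : Type) [Field k] [CharP k p] (m e : ℕ) (he : ((e + 2 : ℕ) : k) ≠ 0)
    (hlow : ∀ G : MvPowerSeries (Fin (m + 1 + 1)) k, IsSingular k G → G.order < ((e + 2 : ℕ) : ℕ∞) → Won k (m + 1 + 1) G)
    (f : MvPowerSeries (Fin (m + 1 + 1)) k) (θ : Fin (m + 1 + 1) → MvPowerSeries (Fin (m + 1 + 1)) k)
    (U : MvPowerSeries (Fin (m + 1 + 1)) k) (a : Fin (e + 1) → MvPowerSeries (Fin (m + 1)) k)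
    (hθ0 : ∀ i, MvPowerSeries.constantCoeff (θ i) = 0)
    (hθdet : IsUnit (Matrix.det (Matrix.of fun i j => MvPowerSeries.coeff (Finsupp.single j 1) (θ i))))
    (hU : MvPowerSeries.constantCoeff U ≠ 0) (hBad : TupleGame.Bad a) (hθf : MvPowerSeries.subst θ f = TupleGame.germ U a)
    (hfin : a = 0 ∨ ∃ n, WinsIn (m := m) GermIsNC n (TupleGame.prodSupport a)) :
    Won k (m + 1 + 1) f := by
  rw [← won_subst_iff hθ0 hθdet, hθf]
  by_cases ha : a = 0
  · subst ha
    rw [germ_zero_eq]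
    exact (stub_purePowerWon k (m + 1) U (MvPowerSeries.X (Fin.last (m + 1))) (e + 2) hU (MvPowerSeries.constantCoeff_X _)
      ⟨Fin.last (m + 1), by rw [MvPowerSeries.coeff_X, if_pos rfl]; exact one_ne_zero⟩).won
  · rcases hfin with h0 | hfin
    · exact absurd h0 ha
    · exact preparedWon_of_winsIn p hp m e he hlow U a hU ha hBad hfin

/-- **TAME GERMS WHOSE TSCHIRNHAUS SUPPORT PRODUCT IS FINITELY NC-WINNABLE ARE WON** (every number `m + 2` of variables; `k` algebraically
closed of characteristic `p ∤ e + 2`): a singular `f` of order `e + 2` such that EVERY Tschirnhaus presentation `f ∘ θ = U · y^{e+2} + Σ a_j y^j`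
(`stub_tschirnhausForm`) has a zero tuple or a finitely NC-winnable support product is won, given the singular germs of smaller order.
[OURS · L1 W4.3] -/
theorem won_of_tschirnhaus_winsIn (p : ℕ) (hp : p.Prime) (k : Type) [Field k] [CharP k p] [IsAlgClosed k] (m e : ℕ)
    (hlow : ∀ G : MvPowerSeries (Fin (m + 1 + 1)) k, IsSingular k G → G.order < ((e + 2 : ℕ) : ℕ∞) → Won k (m + 1 + 1) G)
    (f : MvPowerSeries (Fin (m + 1 + 1)) k) (hf : IsSingular k f) (hfd : f.order = ((e + 2 : ℕ) : ℕ∞)) (hpd : ¬ p ∣ (e + 2))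
    (hsupp : ∀ (θ : Fin (m + 1 + 1) → MvPowerSeries (Fin (m + 1 + 1)) k) (U : MvPowerSeries (Fin (m + 1 + 1)) k)
      (a : Fin (e + 1) → MvPowerSeries (Fin (m + 1)) k),
      (∀ i, MvPowerSeries.constantCoeff (θ i) = 0) →
      IsUnit (Matrix.det (Matrix.of fun i j => MvPowerSeries.coeff (Finsupp.single j 1) (θ i))) →
      MvPowerSeries.constantCoeff U ≠ 0 → TupleGame.Bad a → MvPowerSeries.subst θ f = TupleGame.germ U a → a ≠ 0 →
      ∃ n, WinsIn (m := m) GermIsNC n (TupleGame.prodSupport a)) :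
    Won k (m + 1 + 1) f := by
  obtain ⟨θ, U, a, hθ0, hθdet, hU, hBad, hθf⟩ := stub_tschirnhausForm p hp k (m + 1) e f hf hfd hpd
  have he : ((e + 2 : ℕ) : k) ≠ 0 := fun h => hpd ((CharP.cast_eq_zero_iff k p _).mp h)
  refine won_of_presentation_winsIn p hp k m e he hlow f θ U a hθ0 hθdet hU hBad hθf ?_
  by_cases ha : a = 0
  · exact Or.inl ha
  · exact Or.inr (hsupp θ U a hθ0 hθdet hU hBad hθf ha)

/-- (d1) at `N = 4`: a presented germ in `k⟦x₀,…,x₃⟧` with finitely NC-winnable support product on `k⟦x₀,x₁,x₂⟧` is won. -/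
theorem won_four_of_presentation_winsIn (p : ℕ) (hp : p.Prime) (k : Type) [Field k] [CharP k p] (e : ℕ) (he : ((e + 2 : ℕ) : k) ≠ 0)
    (hlow : ∀ G : MvPowerSeries (Fin 4) k, IsSingular k G → G.order < ((e + 2 : ℕ) : ℕ∞) → Won k 4 G)
    (f : MvPowerSeries (Fin 4) k) (θ : Fin 4 → MvPowerSeries (Fin 4) k) (U : MvPowerSeries (Fin 4) k)
    (a : Fin (e + 1) → MvPowerSeries (Fin 3) k)
    (hθ0 : ∀ i, MvPowerSeries.constantCoeff (θ i) = 0)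
    (hθdet : IsUnit (Matrix.det (Matrix.of fun i j => MvPowerSeries.coeff (Finsupp.single j 1) (θ i))))
    (hU : MvPowerSeries.constantCoeff U ≠ 0) (hBad : TupleGame.Bad a) (hθf : MvPowerSeries.subst θ f = TupleGame.germ U a)
    (hfin : a = 0 ∨ ∃ n, WinsIn (m := 2) GermIsNC n (TupleGame.prodSupport a)) : Won k 4 f :=
  won_of_presentation_winsIn p hp k 2 e he hlow f θ U a hθ0 hθdet hU hBad hθf hfin

/-- (d1) at `N = 4`, Tschirnhaus form: a tame singular `f ∈ k⟦x₀,…,x₃⟧` all of whose Tschirnhaus tuples are zero or have finitely NC-winnable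
support product is won, given the singular germs of smaller order — the shape in which every TOT₂ class enters the residual
`stub_tameWideApexFourStartsWon`. -/
theorem won_four_of_tschirnhaus_winsIn (p : ℕ) (hp : p.Prime) (k : Type) [Field k] [CharP k p] [IsAlgClosed k] (e : ℕ)
    (hlow : ∀ G : MvPowerSeries (Fin 4) k, IsSingular k G → G.order < ((e + 2 : ℕ) : ℕ∞) → Won k 4 G)
    (f : MvPowerSeries (Fin 4) k) (hf : IsSingular k f) (hfd : f.order = ((e + 2 : ℕ) : ℕ∞)) (hpd : ¬ p ∣ (e + 2))
    (hsupp : ∀ (θ : Fin 4 → MvPowerSeries (Fin 4) k) (U : MvPowerSeries (Fin 4) k) (a : Fin (e + 1) → MvPowerSeries (Fin 3) k),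
      (∀ i, MvPowerSeries.constantCoeff (θ i) = 0) →
      IsUnit (Matrix.det (Matrix.of fun i j => MvPowerSeries.coeff (Finsupp.single j 1) (θ i))) →
      MvPowerSeries.constantCoeff U ≠ 0 → TupleGame.Bad a → MvPowerSeries.subst θ f = TupleGame.germ U a → a ≠ 0 →
      ∃ n, WinsIn (m := 2) GermIsNC n (TupleGame.prodSupport a)) :
    Won k 4 f :=
  won_of_tschirnhaus_winsIn p hp k 2 e hlow f hf hfd hpd hsupp

/-! ## (d2) Support classes on `k⟦x₀,x₁,x₂⟧` that are finitely NC-winnable today -/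

/-- **CYLINDERS OVER PLANE CURVE GERMS** (along the last letter) are finitely NC-winnable on `k⟦x₀,x₁,x₂⟧`
(`NCTransport.winsIn_plane` + `winsIn_germIsNC_cylinder`; every field). -/
theorem winsIn_three_cylinder_plane (c : MvPowerSeries (Fin 2) k) (hc : c ≠ 0) :
    ∃ n, WinsIn (m := 2) GermIsNC n (MvPowerSeries.rename (Fin.succAboveEmb (Fin.last 2)) c) := by
  obtain ⟨n, hn⟩ := winsIn_plane k c hc
  have h := winsIn_germIsNC_cylinder 1 0 hc hn
  have hfun : (X ∘ (Fin.succAboveEmb (Fin.last 2)) : Fin 2 → MvPowerSeries (Fin 3) k) =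
      fun i : Fin (1 + 1) => (X ⟨i.val, by omega⟩ : MvPowerSeries (Fin (1 + 0 + 1 + 1)) k) := by
    funext i
    show (X (Fin.succAbove (Fin.last 2) i) : MvPowerSeries (Fin 3) k) = X ⟨i.val, by omega⟩
    rw [Fin.succAbove_last]
    congr 1
  refine ⟨n, ?_⟩
  rw [rename_eq_subst, hfun]
  exact h

/-- **ARRANGEMENTS** `u · ∏ ℓ_j` (unit times a product of non-zero linear forms) are finitely NC-winnable on `k⟦x₀,x₁,x₂⟧`
(res-type-088's `exists_winsIn_arrangement`; every field). -/
theorem winsIn_three_arrangement {ι : Type} [DecidableEq ι] (u : MvPowerSeries (Fin 3) k) (hu : MvPowerSeries.constantCoeff u ≠ 0)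
    (s : Finset ι) (ℓ : ι → Fin 3 → k) (hℓ : ∀ j ∈ s, ℓ j ≠ 0) :
    ∃ n, WinsIn (m := 2) GermIsNC n (u * ∏ j ∈ s, linForm (ℓ j)) :=
  exists_winsIn_arrangement u hu s ℓ hℓ

/-! ## (d3) The `d = 2` headline: `y² + a₀` with `a₀` in a finitely NC-winnable class -/

/-- The prepared germ of the one-entry tuple `(a₀)` with unit `1`: `y² + a₀`. -/
theorem germ_one_single {m : ℕ} (a₀ : MvPowerSeries (Fin (m + 1)) k) :
    TupleGame.germ (1 : MvPowerSeries (Fin (m + 1 + 1)) k) (fun _ : Fin (0 + 1) => a₀) =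
      MvPowerSeries.X (Fin.last (m + 1)) ^ 2 + MvPowerSeries.rename (Fin.succAboveEmb (Fin.last (m + 1))) a₀ := by
  unfold TupleGame.germ
  simp

/-- The one-entry tuple `(a₀)` is bad iff `a₀ = 0` or `ord a₀ ≥ 2`. -/
theorem bad_single {m : ℕ} (a₀ : MvPowerSeries (Fin (m + 1)) k) (hord : (2 : ℕ∞) ≤ a₀.order) :
    TupleGame.Bad (fun _ : Fin (0 + 1) => a₀) := by
  intro j
  refine Or.inr ?_
  have hj : TupleGame.marking 0 j = 2 := by
    rw [TupleGame.marking_eq]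
    have := j.2
    omega
  rw [hj]
  exact_mod_cast hord

/-- The support product of the one-entry tuple `(a₀)`, `a₀ ≠ 0`, is `a₀`. -/
theorem prodSupport_single {m : ℕ} (a₀ : MvPowerSeries (Fin (m + 1)) k) (ha₀ : a₀ ≠ 0) :
    TupleGame.prodSupport (fun _ : Fin (0 + 1) => a₀) = a₀ := by
  classical
  unfold TupleGame.prodSupport
  rw [Fin.prod_univ_one, if_neg ha₀]

/-- At order `2` the «lower orders are won» hypothesis is VACUOUS: a singular germ has order `≥ 2`. -/
theorem lowerOrders_two {n : ℕ} : ∀ G : MvPowerSeries (Fin n) k, IsSingular k G → G.order < ((0 + 2 : ℕ) : ℕ∞) → Won k n G := by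
  intro G hG hlt
  have h2 : (2 : ℕ∞) ≤ G.order := (FormalCoordChange.two_le_order_iff G).mpr hG.2
  exact absurd (lt_of_le_of_lt h2 hlt) (by decide)

/-- **DOUBLE POINTS OVER A FINITELY NC-WINNABLE GERM ARE WON** (every number `m + 2` of variables, characteristic `≠ 2`): for
`a₀ ∈ k⟦x₀,…,x_m⟧`, `a₀ ≠ 0` of order `≥ 2` and finitely NC-winnable in the count game, `y² + a₀` is won — `TameN4.preparedWon_of_winsIn` at
`e = 0` with the vacuous lower-order hypothesis.  At `m + 1 = 3`: the `d = 2` members of T″|₄ over every landed TOT₂ class. [OURS · L1 W4.3] -/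
theorem won_doublePoint_of_winsIn (p : ℕ) (hp : p.Prime) (k : Type) [Field k] [CharP k p] (m : ℕ) (h2 : (2 : k) ≠ 0)
    (a₀ : MvPowerSeries (Fin (m + 1)) k) (ha₀ : a₀ ≠ 0) (hord : (2 : ℕ∞) ≤ a₀.order) (hfin : ∃ n, WinsIn (m := m) GermIsNC n a₀) :
    Won k (m + 1 + 1) (MvPowerSeries.X (Fin.last (m + 1)) ^ 2 + MvPowerSeries.rename (Fin.succAboveEmb (Fin.last (m + 1))) a₀) := by
  rw [← germ_one_single]
  refine preparedWon_of_winsIn p hp m 0 (by simpa using h2) lowerOrders_two 1 (fun _ => a₀) (by simp)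
    (fun h => ha₀ (congrFun h 0)) (bad_single a₀ hord) ?_
  rw [prodSupport_single a₀ ha₀]
  exact hfin

/-- Renaming along an embedding of the letters does not lower the order (`rename = subst (X ∘ e)`, Mathlib's `le_order_subst`). -/
theorem le_order_rename_succAbove {n : ℕ} (j : Fin (n + 2)) (c : MvPowerSeries (Fin (n + 1)) k) :
    c.order ≤ (MvPowerSeries.rename (Fin.succAboveEmb j) c).order := by
  rw [MvPowerSeries.rename_eq_subst]
  have h := MvPowerSeries.le_order_subst (MvPowerSeries.HasSubst.X_comp (R := k) (Fin.succAboveEmb j)) c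
  -- every `X _` has order `1` (it is the monomial `x^{e_s}`), so the infimum of the orders is `≥ 1`
  have h1 : (1 : ℕ∞) ≤ ⨅ i : Fin (n + 1), ((MvPowerSeries.X ∘ Fin.succAboveEmb j) i : MvPowerSeries (Fin (n + 2)) k).order := by
    refine le_iInf fun i => ?_
    rw [Function.comp_apply, MvPowerSeries.X_def, MvPowerSeries.order_monomial_of_ne_zero (one_ne_zero' k),
      Finsupp.degree_single, Nat.cast_one]
  calc c.order = 1 * c.order := (one_mul _).symm
    _ ≤ (⨅ i : Fin (n + 1), ((MvPowerSeries.X ∘ Fin.succAboveEmb j) i : MvPowerSeries (Fin (n + 2)) k).order) * c.order := by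
        gcongr
    _ ≤ _ := h

/-- **`y² + c(x₀,x₁)` IN FOUR VARIABLES IS WON** (`c ≠ 0` of order `≥ 2`, characteristic `≠ 2`) — through the relative lift over the plane
count (also a class-#3 cylinder over the surface germ `y² + c`). [OURS · L1 W4.3] -/
theorem won_four_doublePoint_cylinder_plane (p : ℕ) (hp : p.Prime) (k : Type) [Field k] [CharP k p] (h2 : (2 : k) ≠ 0)
    (c : MvPowerSeries (Fin 2) k) (hc : c ≠ 0) (hord : (2 : ℕ∞) ≤ c.order) :
    Won k 4 (MvPowerSeries.X (Fin.last 3) ^ 2 +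
      MvPowerSeries.rename (Fin.succAboveEmb (Fin.last 3)) (MvPowerSeries.rename (Fin.succAboveEmb (Fin.last 2)) c)) := by
  refine won_doublePoint_of_winsIn p hp k 2 h2 _ ?_ (le_trans hord (le_order_rename_succAbove _ c)) (winsIn_three_cylinder_plane c hc)
  intro h
  exact hc (MvPowerSeries.rename_injective _ (by rw [h, map_zero]))

/-- **`y² + (ARRANGEMENT)` IN FOUR VARIABLES IS WON** (characteristic `≠ 2`): `y² + u·∏_j ℓ_j` with `u(0) ≠ 0`, non-zero linear forms
`ℓ_j` in `x₀,x₁,x₂`, and the arrangement of order `≥ 2` (at least two forms) — e.g. `y² + x₀x₁x₂(x₀+x₁+x₂)`; through the relative lift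
over res-type-088's arrangement rung.  (Not a cylinder, not a product in disjoint letters in general: a new unconditional N = 4 tame class of
EVERY multiplicity `2`… pattern for all `d` via `won_four_of_presentation_winsIn`.) [OURS · L1 W4.3] -/
theorem won_four_doublePoint_arrangement (p : ℕ) (hp : p.Prime) (k : Type) [Field k] [CharP k p] (h2 : (2 : k) ≠ 0) {ι : Type}
    [DecidableEq ι] (u : MvPowerSeries (Fin 3) k) (hu : MvPowerSeries.constantCoeff u ≠ 0) (s : Finset ι) (ℓ : ι → Fin 3 → k)
    (hℓ : ∀ j ∈ s, ℓ j ≠ 0) (hord : (2 : ℕ∞) ≤ (u * ∏ j ∈ s, linForm (ℓ j)).order) :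
    Won k 4 (MvPowerSeries.X (Fin.last 3) ^ 2 + MvPowerSeries.rename (Fin.succAboveEmb (Fin.last 3)) (u * ∏ j ∈ s, linForm (ℓ j))) := by
  refine won_doublePoint_of_winsIn p hp k 2 h2 _ ?_ hord (winsIn_three_arrangement u hu s ℓ hℓ)
  refine mul_ne_zero (fun h => hu ?_) (Finset.prod_ne_zero_iff.mpr fun j hj => linForm_ne_zero (hℓ j hj))
  rw [h, map_zero]

/-! ## Rev 2: every TAME multiplicity — `y^{e+2} + a₀` with `a₀` finitely NC-winnable (the unary-cone starts of T″ over a TOT₂ class) -/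

/-- The prepared germ of the tuple `(a₀, 0, …, 0)` with unit `1`: `y^{e+2} + a₀`. -/
theorem germ_one_head {m e : ℕ} (a₀ : MvPowerSeries (Fin (m + 1)) k) :
    TupleGame.germ (1 : MvPowerSeries (Fin (m + 1 + 1)) k) (fun j : Fin (e + 1) => if j = 0 then a₀ else 0) =
      MvPowerSeries.X (Fin.last (m + 1)) ^ (e + 2) + MvPowerSeries.rename (Fin.succAboveEmb (Fin.last (m + 1))) a₀ := by
  unfold TupleGame.germ
  rw [one_mul, Finset.sum_eq_single (0 : Fin (e + 1))]
  · simp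
  · intro j _ hj
    dsimp only
    rw [if_neg hj, map_zero, zero_mul]
  · intro h
    exact absurd (Finset.mem_univ _) h

/-- The tuple `(a₀, 0, …, 0)` is bad when `ord a₀ ≥ e + 2`. -/
theorem bad_head {m e : ℕ} (a₀ : MvPowerSeries (Fin (m + 1)) k) (hord : ((e + 2 : ℕ) : ℕ∞) ≤ a₀.order) :
    TupleGame.Bad (fun j : Fin (e + 1) => if j = 0 then a₀ else 0) := by
  intro j
  by_cases hj : j = 0
  · subst hj
    refine Or.inr ?_
    dsimp only
    rw [if_pos rfl, TupleGame.marking_eq]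
    simpa using hord
  · exact Or.inl (if_neg hj)

/-- The support product of `(a₀, 0, …, 0)`, `a₀ ≠ 0`, is `a₀`. -/
theorem prodSupport_head {m e : ℕ} (a₀ : MvPowerSeries (Fin (m + 1)) k) (ha₀ : a₀ ≠ 0) :
    TupleGame.prodSupport (fun j : Fin (e + 1) => if j = 0 then a₀ else 0) = a₀ := by
  classical
  unfold TupleGame.prodSupport
  rw [Finset.prod_eq_single (0 : Fin (e + 1))]
  · simp [ha₀]
  · intro j _ hj
    simp [hj]
  · intro h
    exact absurd (Finset.mem_univ _) h

/-- **`y^{e+2} + a₀` OVER A FINITELY NC-WINNABLE GERM IS WON** (every number `m + 2` of variables, `(e + 2 : k) ≠ 0`): for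
`a₀ ∈ k⟦x₀,…,x_m⟧`, `a₀ ≠ 0` of order `≥ e + 2`, finitely NC-winnable, and the singular germs of order `< e + 2` in `m + 2` variables won,
`y^{e+2} + a₀` is won — the UNARY-CONE starts of the tame residual over every TOT₂ class (at `e = 0`: `won_doublePoint_of_winsIn`).
[OURS · L1 W4.3] -/
theorem won_powAdd_of_winsIn (p : ℕ) (hp : p.Prime) (k : Type) [Field k] [CharP k p] (m e : ℕ) (he : ((e + 2 : ℕ) : k) ≠ 0)
    (hlow : ∀ G : MvPowerSeries (Fin (m + 1 + 1)) k, IsSingular k G → G.order < ((e + 2 : ℕ) : ℕ∞) → Won k (m + 1 + 1) G)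
    (a₀ : MvPowerSeries (Fin (m + 1)) k) (ha₀ : a₀ ≠ 0) (hord : ((e + 2 : ℕ) : ℕ∞) ≤ a₀.order)
    (hfin : ∃ n, WinsIn (m := m) GermIsNC n a₀) :
    Won k (m + 1 + 1) (MvPowerSeries.X (Fin.last (m + 1)) ^ (e + 2) + MvPowerSeries.rename (Fin.succAboveEmb (Fin.last (m + 1))) a₀) := by
  rw [← germ_one_head]
  refine preparedWon_of_winsIn p hp m e he hlow 1 _ (by simp) (fun h => ha₀ ?_) (bad_head a₀ hord) ?_
  · have := congrFun h 0
    simpa using this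
  · rw [prodSupport_head a₀ ha₀]
    exact hfin

/-- **`y^{e+2} + (ARRANGEMENT)` IN FOUR VARIABLES IS WON** (`(e + 2 : k) ≠ 0`, arrangement of order `≥ e + 2`, singular germs of order
`< e + 2` in four variables won) — e.g. `y³ + x₀x₁x₂(x₀ − x₂)` in characteristic `≠ 3`. [OURS · L1 W4.3] -/
theorem won_four_powAdd_arrangement (p : ℕ) (hp : p.Prime) (k : Type) [Field k] [CharP k p] (e : ℕ) (he : ((e + 2 : ℕ) : k) ≠ 0)
    (hlow : ∀ G : MvPowerSeries (Fin 4) k, IsSingular k G → G.order < ((e + 2 : ℕ) : ℕ∞) → Won k 4 G) {ι : Type} [DecidableEq ι]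
    (u : MvPowerSeries (Fin 3) k) (hu : MvPowerSeries.constantCoeff u ≠ 0) (s : Finset ι) (ℓ : ι → Fin 3 → k) (hℓ : ∀ j ∈ s, ℓ j ≠ 0)
    (hord : ((e + 2 : ℕ) : ℕ∞) ≤ (u * ∏ j ∈ s, linForm (ℓ j)).order) :
    Won k 4 (MvPowerSeries.X (Fin.last 3) ^ (e + 2) +
      MvPowerSeries.rename (Fin.succAboveEmb (Fin.last 3)) (u * ∏ j ∈ s, linForm (ℓ j))) := by
  refine won_powAdd_of_winsIn p hp k 2 e he hlow _ ?_ hord (winsIn_three_arrangement u hu s ℓ hℓ)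
  refine mul_ne_zero (fun h => hu ?_) (Finset.prod_ne_zero_iff.mpr fun j hj => linForm_ne_zero (hℓ j hj))
  rw [h, map_zero]

/-- **`y^{e+2} + c(x₀,x₁)` IN FOUR VARIABLES IS WON** (`(e + 2 : k) ≠ 0`, `c ≠ 0` of order `≥ e + 2`, lower orders won). [OURS · L1 W4.3] -/
theorem won_four_powAdd_cylinder_plane (p : ℕ) (hp : p.Prime) (k : Type) [Field k] [CharP k p] (e : ℕ) (he : ((e + 2 : ℕ) : k) ≠ 0)
    (hlow : ∀ G : MvPowerSeries (Fin 4) k, IsSingular k G → G.order < ((e + 2 : ℕ) : ℕ∞) → Won k 4 G)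
    (c : MvPowerSeries (Fin 2) k) (hc : c ≠ 0) (hord : ((e + 2 : ℕ) : ℕ∞) ≤ c.order) :
    Won k 4 (MvPowerSeries.X (Fin.last 3) ^ (e + 2) +
      MvPowerSeries.rename (Fin.succAboveEmb (Fin.last 3)) (MvPowerSeries.rename (Fin.succAboveEmb (Fin.last 2)) c)) := by
  refine won_powAdd_of_winsIn p hp k 2 e he hlow _ ?_ (le_trans hord (le_order_rename_succAbove _ c)) (winsIn_three_cylinder_plane c hc)
  intro h
  exact hc (MvPowerSeries.rename_injective _ (by rw [h, map_zero]))

/-! ## Rev 3: the NEWTON NON-DEGENERATE support class (TOT rung R6, `NCTransport.totRungNonDegenerate`, CLOSED by res-D-pv-006 /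
res-type-088 / res-L1-w43-strat-1) — `y^{e+2} + a₀` with `a₀` Newton non-degenerate is won for every tame multiplicity -/

/-- **NEWTON NON-DEGENERATE GERMS** on `k⟦x₀,x₁,x₂⟧` (compact faces, log-Jacobian sense) are finitely NC-winnable — R6 at `m + 1 = 3`
(`NCTransport.totRungNonDegenerate 2`; `k` algebraically closed of characteristic `p`). -/
theorem winsIn_three_newtonNonDegenerate (p : ℕ) (hp : p.Prime) (k : Type) [Field k] [CharP k p] [IsAlgClosed k]
    (b : MvPowerSeries (Fin 3) k) (hb : b ≠ 0) (hND : NewtonNonDegenerate b) : ∃ n, WinsIn (m := 2) GermIsNC n b :=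
  totRungNonDegenerate 2 p hp k b hb hND

/-- **`y^{e+2} + a₀` WITH `a₀` NEWTON NON-DEGENERATE IS WON IN FOUR VARIABLES** (`(e + 2 : k) ≠ 0`, `a₀ ≠ 0` of order `≥ e + 2`,
singular germs of order `< e + 2` won; at `e = 0` the last hypothesis is vacuous, `lowerOrders_two`) — the census's specimen family
`y² + x₀²x₁² + x₂³` (N4-TAME-CENSUS v1.1 §(iii′)) for ALL tame multiplicities, not only divisors of powers. [OURS · L1 W4.3] -/
theorem won_four_powAdd_newtonNonDegenerate (p : ℕ) (hp : p.Prime) (k : Type) [Field k] [CharP k p] [IsAlgClosed k] (e : ℕ)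
    (he : ((e + 2 : ℕ) : k) ≠ 0)
    (hlow : ∀ G : MvPowerSeries (Fin 4) k, IsSingular k G → G.order < ((e + 2 : ℕ) : ℕ∞) → Won k 4 G)
    (a₀ : MvPowerSeries (Fin 3) k) (ha₀ : a₀ ≠ 0) (hord : ((e + 2 : ℕ) : ℕ∞) ≤ a₀.order) (hND : NewtonNonDegenerate a₀) :
    Won k 4 (MvPowerSeries.X (Fin.last 3) ^ (e + 2) + MvPowerSeries.rename (Fin.succAboveEmb (Fin.last 3)) a₀) :=
  won_powAdd_of_winsIn p hp k 2 e he hlow a₀ ha₀ hord (winsIn_three_newtonNonDegenerate p hp k a₀ ha₀ hND)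

/-- The `d = 2` case, hypothesis-free below order `2`: `y² + a₀` with `a₀ ≠ 0` Newton non-degenerate of order `≥ 2` is won in four variables
(characteristic `≠ 2`). [OURS · L1 W4.3] -/
theorem won_four_doublePoint_newtonNonDegenerate (p : ℕ) (hp : p.Prime) (k : Type) [Field k] [CharP k p] [IsAlgClosed k]
    (h2 : (2 : k) ≠ 0) (a₀ : MvPowerSeries (Fin 3) k) (ha₀ : a₀ ≠ 0) (hord : (2 : ℕ∞) ≤ a₀.order) (hND : NewtonNonDegenerate a₀) :
    Won k 4 (MvPowerSeries.X (Fin.last 3) ^ 2 + MvPowerSeries.rename (Fin.succAboveEmb (Fin.last 3)) a₀) :=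
  won_doublePoint_of_winsIn p hp k 2 h2 a₀ ha₀ hord (winsIn_three_newtonNonDegenerate p hp k a₀ ha₀ hND)

end TameN4

end Summit.ResolutionOfSingularities.ResolutionOfSingularities.Theorems
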